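import Summits.Ventures.PackingBounds.Configurations.ListConfig
import Summits.Ventures.PackingBounds.Configurations.SubspaceTransfer

/-!
# Sections: list configurations orthogonal to given integer normals, moved down to `ℝⁿ`

Framing: lottery ticket; floor = certified bounds/negative ranges. Venture `PackingBounds` (cell
`pub-packcert`, seat `pub-packcert-energy`), attained side. A configuration entered by coordinate
lists `L` in `ℝᵐ` (`Configurations/ListConfig`) that is orthogonal to `k` pairwise-orthogonal nonzero
coordinate lists `S` (Boolean checks `orthOK`, `normalsOK`, run by `decide`) lies in an
`n = m - k`-dimensional subspace, so `Configurations/SubspaceTransfer` produces a configuration in `ℝⁿ`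
with the same cardinality, unit norms, tabulated inner products and energies (`exists_section`).
Clients: the `56`- and `27`-point sharp configurations (sections of the `E₈` roots), the Leech-lattice
sections (`100`, `112`, `162`, `275`, `552` points).
-/

namespace Summit.Ventures.PackingBounds.Config

open Finset

variable {R : Type*} [CommRing R] [DecidableEq R]

/-- Orthogonality check: every member of `L` has dot product `0` with every member of `S`. -/
def orthOK (S L : List (List R)) : Bool :=
  L.all fun l => S.all fun s => dotL s l == 0

/-- Normal-frame check: the members of `S` have length `n`, nonzero self-dot-product, and are
pairwise orthogonal. -/
def normalsOK (S : List (List R)) (n : ℕ) : Bool :=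
  (S.all fun s => s.length == n && !(dotL s s == 0)) && decide (S.Pairwise fun s t => dotL s t = 0)

variable {ι : R →+* ℝ} {m : ℕ} {q : R} {L : List (List R)} {D : List (R × ℕ)}

/-- The normal vectors attached to `S` are linearly independent. -/
theorem linearIndependent_normals (hι : Function.Injective ι) (hq : 0 < ι q) (S : List (List R))
    (hSn : normalsOK S m = true) :
    LinearIndependent ℝ (fun i : Fin S.length => vec ι m q S[(i : ℕ)]) := by
  simp only [normalsOK, Bool.and_eq_true, List.all_eq_true, decide_eq_true_eq, beq_iff_eq,
    Bool.not_eq_true', beq_eq_false_iff_ne, ne_eq] at hSn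
  obtain ⟨hlen, hpw⟩ := hSn
  rw [List.pairwise_iff_getElem] at hpw
  refine linearIndependent_of_ne_zero_of_inner_eq_zero (𝕜 := ℝ) (fun i h0 => ?_) (fun i j hij => ?_)
  · have hs := hlen _ (List.getElem_mem i.2)
    have h := inner_vec ι m q hq S[(i : ℕ)] S[(i : ℕ)] hs.1 hs.1
    rw [h0, inner_zero_left, eq_comm, div_eq_zero_iff] at h
    rcases h with h | h
    · exact hs.2 (hι (by rw [h, map_zero]))
    · exact hq.ne' h
  · have hi := (hlen _ (List.getElem_mem i.2)).1
    have hj := (hlen _ (List.getElem_mem j.2)).1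
    rcases lt_or_gt_of_ne (Fin.val_ne_of_ne hij) with hlt | hlt
    · show inner ℝ (vec ι m q S[(i : ℕ)]) (vec ι m q S[(j : ℕ)]) = 0
      rw [inner_vec ι m q hq _ _ hi hj, hpw _ _ i.2 j.2 hlt, map_zero, zero_div]
    · show inner ℝ (vec ι m q S[(i : ℕ)]) (vec ι m q S[(j : ℕ)]) = 0
      rw [real_inner_comm, inner_vec ι m q hq _ _ hj hi, hpw _ _ j.2 i.2 hlt, map_zero, zero_div]

/-- The configuration is orthogonal to the normal vectors. -/
theorem inner_normals_eq_zero (hq : 0 < ι q) (hS : shapeOK L m q = true) (S : List (List R))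
    (hSn : normalsOK S m = true) (hO : orthOK S L = true) :
    ∀ x ∈ config ι m q L, ∀ i : Fin S.length, inner ℝ (vec ι m q S[(i : ℕ)]) x = 0 := by
  simp only [normalsOK, Bool.and_eq_true, List.all_eq_true, decide_eq_true_eq, beq_iff_eq,
    Bool.not_eq_true', beq_eq_false_iff_ne, ne_eq] at hSn
  simp only [orthOK, List.all_eq_true, beq_iff_eq] at hO
  intro x hx i
  obtain ⟨l, hl, rfl⟩ := mem_config.1 hx
  rw [inner_vec ι m q hq _ _ (hSn.1 _ (List.getElem_mem i.2)).1 (length_of_shapeOK hS hl),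
    hO l hl _ (List.getElem_mem i.2), map_zero, zero_div]

/-- **Section transfer.** A list configuration in `ℝᵐ` passing the shape/table/histogram checks and
orthogonal to `k = |S|` pairwise-orthogonal nonzero normals, with `m = n + k`, yields a configuration
of `|L|` unit vectors in `ℝⁿ` whose pairwise inner products are the tabulated ones and whose
`a`-energy is `|L| · Σ_{(d,m) ∈ D} m · a(ι d / ι q)` for every potential `a`. -/
theorem exists_section (hι : Function.Injective ι) (hq : 0 < ι q) (hS : shapeOK L m q = true)
    (hK : keysOK D q = true) (hH : histOK L D L = true) (hN : L.Nodup) (S : List (List R))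
    (hSn : normalsOK S m = true) (hO : orthOK S L = true) {n : ℕ} (hm : m = n + S.length) :
    ∃ C' : Finset (EuclideanSpace ℝ (Fin n)), C'.card = L.length ∧ (∀ x ∈ C', ‖x‖ = 1) ∧
      (∀ x ∈ C', ∀ y ∈ C', x ≠ y → ∃ p ∈ D, inner ℝ x y = ι p.1 / ι q) ∧
      ∀ a : ℝ → ℝ, ∑ x ∈ C', ∑ y ∈ C'.erase x, a (inner ℝ x y) =
        (L.length : ℝ) * (D.map fun p => (p.2 : ℝ) * a (ι p.1 / ι q)).sum := by
  obtain ⟨C', hcard, hnorm, hinner, henergy⟩ := exists_transfer_orthogonal hm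
    (fun i : Fin S.length => vec ι m q S[(i : ℕ)]) (linearIndependent_normals hι hq S hSn)
    (config ι m q L) (inner_normals_eq_zero hq hS S hSn hO)
  refine ⟨C', ?_, ?_, ?_, ?_⟩
  · rw [hcard, card_eq hι hq hS hK hH hN]
  · intro x' hx'
    obtain ⟨x, hx, he⟩ := hnorm x' hx'
    rw [he]
    exact norm_eq_one hq hS x hx
  · intro x' hx' y' hy' hne
    obtain ⟨x, hx, y, hy, hxy, he⟩ := hinner x' hx' y' hy' hne
    rw [he]
    exact inner_mem hq hS hH x hx y hy hxy
  · intro a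
    rw [henergy a]
    exact energy_eq hι hq hS hK hH hN a

end Summit.Ventures.PackingBounds.Config
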